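import Summits.RiemannHypothesis.RiemannHypothesis.Theorems.NymanBeurlingVasyuninLayerCake
import HarnessLib

/-!
# RiemannHypothesis / Nyman–Beurling — Vasyunin's formula for the Gram matrix, II: the finite master identity (RH-FREE)

Second of three files discharging `Literature.NumberTheory.LFunctions.BBLS2003_prop89` (plan in part I,
`NymanBeurlingVasyuninLayerCake.lean`).  For coprime `p, q ≥ 1` and `M ≥ 1`:

* the double sum `S(M) = Σ_{1≤j<pM} Σ_{1≤k<qM} 1/max(j/p, k/q)` by inclusion–exclusion on the order of `pk` and `qj`
  (`#{k : pk ≤ qj} = ⌊qj/p⌋`, `⌊a/b⌋ = a/b − {a/b}`, diagonal `pk = qj ⇔ (j,k) = (pm,qm)` by coprimality): `sum_sum_one_div_max_eq`;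
* the **finite master identity** `integral_fract_mul_fract_eq`: `∫_0^M {px}{qx} x⁻² dx = 2pqM − p(qM log(qM) − log (qM)!)
  − q(pM log(pM) − log (pM)!) − H_{M−1} − 1/M − qΣ_{k<qM} {pk/q}/k − pΣ_{j<pM} {qj/p}/j`;
* the residue re-indexing `qΣ_{k<qM} {pk/q}/k = Σ_{1≤r<q} {pr/q} Σ_{n<M} q/(qn+r)`, `Σ_{1≤r<q} Σ_{n<M} q/(qn+r) = qH_{qM−1} − H_{M−1}`,
  and the antisymmetrisation `2Σ_r {pr/q} h(r) = Σ_r h(r) + Σ_r {pr/q}(h(r) − h(q−r))` from `{p(q−r)/q} = 1 − {pr/q}`, whose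
  differences `Σ_{n<M} (1/(n + r/q) − 1/(n + 1 − r/q))` are the partial sums of the cotangent series.
RH-FREE [rh-li-eng-3 g4]: elementary bookkeeping; nothing here bears on the truth of RH.
-/

noncomputable section

-- D-0017: `Summit.<S>.<S>.…` is the designed namespace of a single-problem summit.
set_option linter.dupNamespace false

open MeasureTheory Set
namespace Summit.RiemannHypothesis.RiemannHypothesis.Theorems.NbTheory

open Literature.NumberTheory.LFunctions
namespace Vasyunin

/-! ## Step 4: the double sum `S(M) = Σ_{j<pM, k<qM} 1/max(j/p, k/q)` -/

/-- Inclusion–exclusion for `1/max(j/p, k/q)` according to the order of `pk` and `qj`. -/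
theorem one_div_max_eq_ite {p q : ℕ} (j k : ℕ) (hp : 0 < p) (hq : 0 < q) :
    1 / max ((j : ℝ) / p) ((k : ℝ) / q) =
      (if p * k ≤ q * j then (p : ℝ) / j else 0) + (if q * j ≤ p * k then (q : ℝ) / k else 0)
        - (if p * k = q * j then (p : ℝ) / j else 0) := by
  have hp' : (0 : ℝ) < p := by exact_mod_cast hp
  have hq' : (0 : ℝ) < q := by exact_mod_cast hq
  have key : ((k : ℝ) / q ≤ (j : ℝ) / p ↔ p * k ≤ q * j) := by
    rw [div_le_div_iff₀ hq' hp']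
    constructor
    · intro h
      have : ((p * k : ℕ) : ℝ) ≤ ((q * j : ℕ) : ℝ) := by push_cast; linarith
      exact_mod_cast this
    · intro h
      have : ((p * k : ℕ) : ℝ) ≤ ((q * j : ℕ) : ℝ) := by exact_mod_cast h
      push_cast at this
      linarith
  have key' : ((j : ℝ) / p ≤ (k : ℝ) / q ↔ q * j ≤ p * k) := by
    rw [div_le_div_iff₀ hp' hq']
    constructor
    · intro h
      have : ((q * j : ℕ) : ℝ) ≤ ((p * k : ℕ) : ℝ) := by push_cast; linarith
      exact_mod_cast this
    · intro h
      have : ((q * j : ℕ) : ℝ) ≤ ((p * k : ℕ) : ℝ) := by exact_mod_cast h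
      push_cast at this
      linarith
  rcases lt_trichotomy (p * k) (q * j) with h | h | h
  · have h1 : p * k ≤ q * j := h.le
    have h2 : ¬ q * j ≤ p * k := not_le.mpr h
    have h3 : p * k ≠ q * j := h.ne
    rw [if_pos h1, if_neg h2, if_neg h3, max_eq_left (key.mpr h1), add_zero, sub_zero, one_div_div]
  · have h1 : p * k ≤ q * j := h.le
    have h2 : q * j ≤ p * k := h.ge
    rw [if_pos h1, if_pos h2, if_pos h, max_eq_right (key'.mpr h2), one_div_div]
    ring
  · have h1 : ¬ p * k ≤ q * j := not_le.mpr h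
    have h2 : q * j ≤ p * k := h.le
    have h3 : p * k ≠ q * j := h.ne'
    rw [if_neg h1, if_pos h2, if_neg h3, max_eq_right (key'.mpr h2), zero_add, sub_zero, one_div_div]

/-- Counting: for `1 ≤ j < pM`, `#{1 ≤ k < qM : pk ≤ qj} = ⌊qj/p⌋`, as a sum. -/
theorem sum_ite_mul_le_eq {p q M j : ℕ} (hp : 0 < p) (hq : 0 < q) (hj : j ∈ Finset.Ico 1 (p * M)) (c : ℝ) :
    ∑ k ∈ Finset.Ico 1 (q * M), (if p * k ≤ q * j then c else 0) = ((q * j / p : ℕ) : ℝ) * c := by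
  rw [Finset.mem_Ico] at hj
  have hlt : q * j / p < q * M := by
    rw [Nat.div_lt_iff_lt_mul hp]
    calc q * j < q * (p * M) := Nat.mul_lt_mul_of_pos_left hj.2 hq
      _ = q * M * p := by ring
  have hfilter : (Finset.Ico 1 (q * M)).filter (fun k => p * k ≤ q * j) = Finset.Ico 1 (q * j / p + 1) := by
    ext k
    simp only [Finset.mem_filter, Finset.mem_Ico, Nat.lt_succ_iff]
    rw [Nat.le_div_iff_mul_le hp, mul_comm k p]
    constructor
    · rintro ⟨⟨h1, -⟩, h2⟩; exact ⟨h1, h2⟩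
    · rintro ⟨h1, h2⟩
      refine ⟨⟨h1, ?_⟩, h2⟩
      have : k ≤ q * j / p := by rw [Nat.le_div_iff_mul_le hp, mul_comm k p]; exact h2
      exact lt_of_le_of_lt this hlt
  rw [← Finset.sum_filter, hfilter, Finset.sum_const, Nat.card_Ico, Nat.add_sub_cancel, nsmul_eq_mul]

/-- `⌊a/b⌋ = a/b − {a/b}` for the natural-number quotient, in `ℝ`. -/
theorem natCast_div_eq_sub_fract (a : ℕ) {b : ℕ} (hb : 0 < b) :
    ((a / b : ℕ) : ℝ) = (a : ℝ) / b - Int.fract ((a : ℝ) / b) := by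
  rw [Int.fract_div_natCast_eq_div_natCast_mod]
  have h := Nat.div_add_mod a b
  have hb' : (b : ℝ) ≠ 0 := by exact_mod_cast hb.ne'
  have hcast : (b : ℝ) * ((a / b : ℕ) : ℝ) + ((a % b : ℕ) : ℝ) = a := by exact_mod_cast h
  field_simp
  linarith

/-- The `pk ≤ qj` part of `S(M)`: `Σ_j Σ_k 1[pk ≤ qj]·p/j = q(pM − 1) − p Σ_j {qj/p}/j`. -/
theorem sum_sum_ite_le_eq {p q M : ℕ} (hp : 0 < p) (hq : 0 < q) (hM : 0 < M) :
    ∑ j ∈ Finset.Ico 1 (p * M), ∑ k ∈ Finset.Ico 1 (q * M), (if p * k ≤ q * j then (p : ℝ) / j else 0) =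
      (q : ℝ) * ((p : ℝ) * M - 1) - p * ∑ j ∈ Finset.Ico 1 (p * M), Int.fract ((q : ℝ) * j / p) / j := by
  have hp' : (p : ℝ) ≠ 0 := by exact_mod_cast hp.ne'
  have hterm : ∀ j ∈ Finset.Ico 1 (p * M),
      ∑ k ∈ Finset.Ico 1 (q * M), (if p * k ≤ q * j then (p : ℝ) / j else 0) =
        q - p * (Int.fract ((q : ℝ) * j / p) / j) := by
    intro j hj
    rw [sum_ite_mul_le_eq hp hq hj, natCast_div_eq_sub_fract _ hp]
    rw [Finset.mem_Ico] at hj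
    have hj' : (j : ℝ) ≠ 0 := by
      have : (1 : ℝ) ≤ j := by exact_mod_cast hj.1
      positivity
    have e : ((q * j : ℕ) : ℝ) / p * ((p : ℝ) / j) = q := by
      push_cast
      field_simp
    push_cast at e ⊢
    rw [sub_mul, e]
    ring
  rw [Finset.sum_congr rfl hterm, Finset.sum_sub_distrib, Finset.sum_const, Nat.card_Ico, nsmul_eq_mul,
    ← Finset.mul_sum]
  have h1 : 1 ≤ p * M := Nat.one_le_iff_ne_zero.mpr (Nat.mul_ne_zero hp.ne' hM.ne')
  rw [Nat.cast_sub h1]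
  push_cast
  ring

/-- Multiples of `p` in `[1, pM)`: `Σ_{1 ≤ j < pM, p ∣ j} f(j) = Σ_{1 ≤ m < M} f(pm)`. -/
theorem sum_Ico_ite_dvd_eq {p M : ℕ} (hp : 0 < p) (f : ℕ → ℝ) :
    ∑ j ∈ Finset.Ico 1 (p * M), (if p ∣ j then f j else 0) = ∑ m ∈ Finset.Ico 1 M, f (p * m) := by
  rw [← Finset.sum_filter]
  have himage : (Finset.Ico 1 (p * M)).filter (fun j => p ∣ j) = (Finset.Ico 1 M).image (fun m => p * m) := by
    ext j
    simp only [Finset.mem_filter, Finset.mem_Ico, Finset.mem_image]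
    constructor
    · rintro ⟨⟨h1, h2⟩, ⟨m, rfl⟩⟩
      refine ⟨m, ⟨?_, ?_⟩, rfl⟩
      · rcases Nat.eq_zero_or_pos m with h | h
        · subst h; simp at h1
        exact h
      · exact Nat.lt_of_mul_lt_mul_left h2
    · rintro ⟨m, ⟨h1, h2⟩, rfl⟩
      refine ⟨⟨?_, Nat.mul_lt_mul_of_pos_left h2 hp⟩, dvd_mul_right p m⟩
      exact Nat.one_le_iff_ne_zero.mpr (Nat.mul_ne_zero hp.ne' (by omega))
  rw [himage, Finset.sum_image]
  intro a _ b _ hab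
  exact Nat.eq_of_mul_eq_mul_left hp hab

/-- The diagonal of `S(M)`: `Σ_j Σ_k 1[pk = qj]·p/j = Σ_{1 ≤ m < M} 1/m` (coprimality: `pk = qj ⇔ (j,k) = (pm,qm)`). -/
theorem sum_sum_ite_eq_eq {p q M : ℕ} (hp : 0 < p) (hq : 0 < q) (hpq : Nat.Coprime p q) :
    ∑ j ∈ Finset.Ico 1 (p * M), ∑ k ∈ Finset.Ico 1 (q * M), (if p * k = q * j then (p : ℝ) / j else 0) =
      ∑ m ∈ Finset.Ico 1 M, 1 / (m : ℝ) := by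
  have hp' : (p : ℝ) ≠ 0 := by exact_mod_cast hp.ne'
  have hinner : ∀ j ∈ Finset.Ico 1 (p * M),
      ∑ k ∈ Finset.Ico 1 (q * M), (if p * k = q * j then (p : ℝ) / j else 0) =
        if p ∣ j then (p : ℝ) / j else 0 := by
    intro j hj
    rw [Finset.mem_Ico] at hj
    by_cases hdvd : p ∣ j
    · rw [if_pos hdvd]
      obtain ⟨m, rfl⟩ := hdvd
      have hm1 : 1 ≤ m := by
        rcases Nat.eq_zero_or_pos m with h | h
        · subst h; simp at hj
        · exact h
      have hmM : m < M := Nat.lt_of_mul_lt_mul_left hj.2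
      have hcond : ∀ k : ℕ, (p * k = q * (p * m) ↔ k = q * m) := by
        intro k
        constructor
        · intro h
          apply Nat.eq_of_mul_eq_mul_left hp
          rw [h]; ring
        · rintro rfl; ring
      simp_rw [hcond]
      rw [Finset.sum_ite_eq' (Finset.Ico 1 (q * M)) (q * m) (fun _ => (p : ℝ) / ((p * m : ℕ) : ℝ))]
      rw [if_pos]
      rw [Finset.mem_Ico]
      exact ⟨Nat.one_le_iff_ne_zero.mpr (Nat.mul_ne_zero hq.ne' (by omega)), Nat.mul_lt_mul_of_pos_left hmM hq⟩
    · rw [if_neg hdvd]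
      refine Finset.sum_eq_zero fun k _ => ?_
      rw [if_neg]
      intro h
      apply hdvd
      have : p ∣ q * j := ⟨k, h.symm⟩
      exact hpq.dvd_of_dvd_mul_left this
  rw [Finset.sum_congr rfl hinner, sum_Ico_ite_dvd_eq hp]
  refine Finset.sum_congr rfl fun m hm => ?_
  rw [Finset.mem_Ico] at hm
  have hm' : (m : ℝ) ≠ 0 := by
    have : (1 : ℝ) ≤ m := by exact_mod_cast hm.1
    positivity
  push_cast
  field_simp

/-- **The double sum:** `S(M) = Σ_{j<pM} Σ_{k<qM} 1/max(j/p,k/q) = q(pM−1) + p(qM−1) − H_{M−1} − pΣ_j{qj/p}/j − qΣ_k{pk/q}/k`. -/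
theorem sum_sum_one_div_max_eq {p q M : ℕ} (hp : 0 < p) (hq : 0 < q) (hpq : Nat.Coprime p q) (hM : 0 < M) :
    ∑ j ∈ Finset.Ico 1 (p * M), ∑ k ∈ Finset.Ico 1 (q * M), 1 / max ((j : ℝ) / p) ((k : ℝ) / q) =
      (q : ℝ) * ((p : ℝ) * M - 1) + (p : ℝ) * ((q : ℝ) * M - 1) - ∑ m ∈ Finset.Ico 1 M, 1 / (m : ℝ)
        - p * ∑ j ∈ Finset.Ico 1 (p * M), Int.fract ((q : ℝ) * j / p) / j
        - q * ∑ k ∈ Finset.Ico 1 (q * M), Int.fract ((p : ℝ) * k / q) / k := by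
  rw [Finset.sum_congr rfl fun j _ => Finset.sum_congr rfl fun k _ => one_div_max_eq_ite j k hp hq]
  simp only [Finset.sum_sub_distrib, Finset.sum_add_distrib]
  rw [sum_sum_ite_le_eq hp hq hM, sum_sum_ite_eq_eq hp hq hpq, Finset.sum_comm, sum_sum_ite_le_eq hq hp hM]
  ring

/-! ## Step 5: the finite master identity -/

/-- **Finite master identity.** For coprime `p, q ≥ 1` and `M ≥ 1`:
`∫_0^M {px}{qx} x⁻² dx = 2pqM − p(qM log(qM) − log (qM)!) − q(pM log(pM) − log (pM)!) − H_{M−1} − 1/M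
  − qΣ_{k<qM} {pk/q}/k − pΣ_{j<pM} {qj/p}/j`. -/
theorem integral_fract_mul_fract_eq {p q M : ℕ} (hp : 0 < p) (hq : 0 < q) (hpq : Nat.Coprime p q) (hM : 0 < M) :
    ∫ x in (0 : ℝ)..M, Int.fract ((p : ℝ) * x) * Int.fract ((q : ℝ) * x) / x ^ 2 =
      2 * (p : ℝ) * q * M
        - p * ((q : ℝ) * M * Real.log ((q : ℝ) * M) - Real.log ((q * M).factorial))
        - q * ((p : ℝ) * M * Real.log ((p : ℝ) * M) - Real.log ((p * M).factorial))
        - ∑ m ∈ Finset.Ico 1 M, 1 / (m : ℝ) - 1 / M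
        - q * ∑ k ∈ Finset.Ico 1 (q * M), Int.fract ((p : ℝ) * k / q) / k
        - p * ∑ j ∈ Finset.Ico 1 (p * M), Int.fract ((q : ℝ) * j / p) / j := by
  have hM' : (M : ℝ) ≠ 0 := by exact_mod_cast hM.ne'
  rw [integral_fract_mul_fract_eq_sums hp hq hM, sum_Ico_mul_log_div hq hM, sum_Ico_mul_log_div hp hM]
  simp only [Finset.sum_sub_distrib]
  rw [sum_sum_one_div_max_eq hp hq hpq hM]
  simp only [Finset.sum_const, Nat.card_Ico, nsmul_eq_mul]
  have h1 : 1 ≤ p * M := Nat.one_le_iff_ne_zero.mpr (Nat.mul_ne_zero hp.ne' hM.ne')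
  have h2 : 1 ≤ q * M := Nat.one_le_iff_ne_zero.mpr (Nat.mul_ne_zero hq.ne' hM.ne')
  rw [Nat.cast_sub h1, Nat.cast_sub h2]
  push_cast
  field_simp
  ring

/-! ## Step 6: re-indexing the fractional sums by residues, antisymmetrisation -/

/-- Splitting off the `r = 0` term: `Σ_{r<q} f(r) = f(0) + Σ_{1≤r<q} f(r)` (`q ≥ 1`). -/
theorem sum_range_eq_add_sum_Ico (f : ℕ → ℝ) {q : ℕ} (hq : 0 < q) :
    ∑ r ∈ Finset.range q, f r = f 0 + ∑ r ∈ Finset.Ico 1 q, f r := by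
  rw [Finset.range_eq_Ico, Finset.sum_eq_sum_Ico_succ_bot hq]

/-- `Σ_{k<qM} g(k mod q)·q/k = Σ_{r<q} g(r)·Σ_{n<M} q/(qn+r)` (the `k = 0` and `(n,r) = (0,0)` terms are `q/0 = 0`). -/
theorem sum_range_mul_mod_eq {q : ℕ} (g : ℕ → ℝ) (M : ℕ) :
    ∑ k ∈ Finset.range (q * M), g (k % q) * ((q : ℝ) / k) =
      ∑ r ∈ Finset.range q, g r * ∑ n ∈ Finset.range M, (q : ℝ) / ((q : ℝ) * n + r) := by
  induction M with
  | zero => simp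
  | succ M ih =>
    rw [mul_add_one, Finset.sum_range_add, ih]
    simp only [Finset.sum_range_succ, mul_add, Finset.sum_add_distrib]
    congr 1
    refine Finset.sum_congr rfl fun r hr => ?_
    rw [Finset.mem_range] at hr
    have hmod : (q * M + r) % q = r := by
      rw [add_comm, Nat.add_mul_mod_self_left, Nat.mod_eq_of_lt hr]
    rw [hmod]
    norm_cast

/-- The residue re-indexing of the fractional sums:
`q·Σ_{1≤k<qM} {pk/q}/k = Σ_{1≤r<q} {pr/q}·Σ_{n<M} q/(qn+r)`. -/
theorem sum_fract_div_eq_sum_residue (p : ℕ) {q : ℕ} (hq : 0 < q) (M : ℕ) :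
    (q : ℝ) * ∑ k ∈ Finset.Ico 1 (q * M), Int.fract ((p : ℝ) * k / q) / k =
      ∑ r ∈ Finset.Ico 1 q, Int.fract ((p : ℝ) * r / q) * ∑ n ∈ Finset.range M, (q : ℝ) / ((q : ℝ) * n + r) := by
  have hq' : (q : ℝ) ≠ 0 := by exact_mod_cast hq.ne'
  have hL : (q : ℝ) * ∑ k ∈ Finset.Ico 1 (q * M), Int.fract ((p : ℝ) * k / q) / k =
      ∑ k ∈ Finset.range (q * M), Int.fract ((p : ℝ) * ↑(k % q) / q) * ((q : ℝ) / k) := by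
    rw [Finset.mul_sum]
    by_cases hM : M = 0
    · subst hM; simp
    have hqM : 0 < q * M := Nat.mul_pos hq (Nat.pos_of_ne_zero hM)
    rw [sum_range_eq_add_sum_Ico _ hqM]
    simp only [Nat.cast_zero, div_zero, mul_zero, zero_add]
    refine Finset.sum_congr rfl fun k _ => ?_
    have hmod : Int.fract ((p : ℝ) * ↑(k % q) / q) = Int.fract ((p : ℝ) * k / q) := by
      have hk : (k : ℝ) = (q : ℝ) * ↑(k / q) + ↑(k % q) := by exact_mod_cast (Nat.div_add_mod k q).symm
      have : (p : ℝ) * k / q = ((p * (k / q) : ℕ) : ℝ) + (p : ℝ) * ↑(k % q) / q := by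
        rw [hk, mul_add, add_div]
        push_cast
        congr 1
        field_simp
      rw [this, Int.fract_natCast_add]
    rw [hmod]
    ring
  have hR : ∑ r ∈ Finset.range q, Int.fract ((p : ℝ) * r / q) * ∑ n ∈ Finset.range M, (q : ℝ) / ((q : ℝ) * n + r) =
      ∑ r ∈ Finset.Ico 1 q, Int.fract ((p : ℝ) * r / q) * ∑ n ∈ Finset.range M, (q : ℝ) / ((q : ℝ) * n + r) := by
    rw [sum_range_eq_add_sum_Ico _ hq]
    simp
  rw [hL, ← hR]
  exact sum_range_mul_mod_eq (fun r => Int.fract ((p : ℝ) * r / q)) M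

/-- `Σ_{k<N+1} 1/k = H_N` (with `1/0 = 0`). -/
theorem sum_range_one_div_eq_harmonic (N : ℕ) :
    ∑ k ∈ Finset.range (N + 1), 1 / (k : ℝ) = (harmonic N : ℝ) := by
  induction N with
  | zero => simp
  | succ N ih =>
    rw [Finset.sum_range_succ, ih, harmonic_succ]
    push_cast
    ring

/-- `Σ_{1≤m<M} 1/m = H_{M−1}`. -/
theorem sum_Ico_one_div_eq_harmonic {M : ℕ} (hM : 0 < M) :
    ∑ m ∈ Finset.Ico 1 M, 1 / (m : ℝ) = (harmonic (M - 1) : ℝ) := by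
  obtain ⟨N, rfl⟩ : ∃ N, M = N + 1 := ⟨M - 1, by omega⟩
  rw [Nat.add_sub_cancel, ← sum_range_one_div_eq_harmonic, sum_range_eq_add_sum_Ico _ (Nat.succ_pos N)]
  simp

/-- `Σ_{k<nM} n/k = n·H_{nM−1}` for `n, M ≥ 1`. -/
theorem sum_range_div_eq_harmonic {n M : ℕ} (hn : 0 < n) (hM : 0 < M) :
    ∑ k ∈ Finset.range (n * M), (n : ℝ) / k = n * (harmonic (n * M - 1) : ℝ) := by
  obtain ⟨N, hN⟩ : ∃ N, n * M = N + 1 :=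
    ⟨n * M - 1, by have : 1 ≤ n * M := Nat.one_le_iff_ne_zero.mpr (Nat.mul_ne_zero hn.ne' hM.ne'); omega⟩
  rw [hN, Nat.add_sub_cancel, ← sum_range_one_div_eq_harmonic, Finset.mul_sum]
  refine Finset.sum_congr rfl fun k _ => ?_
  ring

/-- The full residue sum: `Σ_{1≤r<q} Σ_{n<M} q/(qn+r) = q·H_{qM−1} − H_{M−1}` (`M ≥ 1`). -/
theorem sum_Ico_sum_range_div_eq {q M : ℕ} (hq : 0 < q) (hM : 0 < M) :
    ∑ r ∈ Finset.Ico 1 q, ∑ n ∈ Finset.range M, (q : ℝ) / ((q : ℝ) * n + r) =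
      q * (harmonic (q * M - 1) : ℝ) - (harmonic (M - 1) : ℝ) := by
  have hall := sum_range_mul_mod_eq (q := q) (fun _ => (1 : ℝ)) M
  simp only [one_mul] at hall
  rw [sum_range_div_eq_harmonic hq hM, sum_range_eq_add_sum_Ico _ hq] at hall
  have h0 : ∑ n ∈ Finset.range M, (q : ℝ) / ((q : ℝ) * n + ((0 : ℕ) : ℝ)) = (harmonic (M - 1) : ℝ) := by
    obtain ⟨N, rfl⟩ : ∃ N, M = N + 1 := ⟨M - 1, by omega⟩
    rw [Nat.add_sub_cancel, ← sum_range_one_div_eq_harmonic]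
    refine Finset.sum_congr rfl fun n _ => ?_
    have hq' : (q : ℝ) ≠ 0 := by exact_mod_cast hq.ne'
    rw [Nat.cast_zero, add_zero, div_mul_eq_div_div, div_self hq']
  rw [h0] at hall
  linarith

/-- The reflected residue: for `1 ≤ r < q` coprime data, `{p(q−r)/q} = 1 − {pr/q}`. -/
theorem fract_mul_sub_div_eq {p q r : ℕ} (hpq : Nat.Coprime p q) (hr : r ∈ Finset.Ico 1 q) :
    Int.fract ((p : ℝ) * ↑(q - r) / q) = 1 - Int.fract ((p : ℝ) * r / q) := by
  rw [Finset.mem_Ico] at hr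
  have hq : 0 < q := by omega
  have hq' : (q : ℝ) ≠ 0 := by exact_mod_cast hq.ne'
  have hne : Int.fract ((p : ℝ) * r / q) ≠ 0 := by
    rw [show (p : ℝ) * r / q = ((p * r : ℕ) : ℝ) / q by push_cast; ring,
      Int.fract_div_natCast_eq_div_natCast_mod]
    have hmod : (p * r) % q ≠ 0 := by
      intro h0
      have hdvd : q ∣ p * r := Nat.dvd_of_mod_eq_zero h0
      have hqr : q ∣ r := hpq.symm.dvd_of_dvd_mul_left hdvd
      exact absurd (Nat.le_of_dvd (by omega) hqr) (by omega)
    have : ((p * r % q : ℕ) : ℝ) ≠ 0 := by exact_mod_cast hmod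
    exact div_ne_zero this hq'
  rw [Nat.cast_sub hr.2.le,
    show (p : ℝ) * ((q : ℝ) - r) / q = -((p : ℝ) * r / q) + (p : ℕ) by field_simp; ring,
    Int.fract_add_natCast, Int.fract_neg hne]

/-- **Antisymmetrisation:** `2·Σ_{1≤r<q} {pr/q} h(r) = Σ_{1≤r<q} h(r) + Σ_{1≤r<q} {pr/q}(h(r) − h(q−r))`. -/
theorem two_mul_sum_fract_mul_eq {p q : ℕ} (hpq : Nat.Coprime p q) (h : ℕ → ℝ) :
    2 * ∑ r ∈ Finset.Ico 1 q, Int.fract ((p : ℝ) * r / q) * h r =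
      ∑ r ∈ Finset.Ico 1 q, h r + ∑ r ∈ Finset.Ico 1 q, Int.fract ((p : ℝ) * r / q) * (h r - h (q - r)) := by
  have hrefl : ∀ f : ℕ → ℝ, ∑ r ∈ Finset.Ico 1 q, f (q - r) = ∑ r ∈ Finset.Ico 1 q, f r := by
    intro f
    have := Finset.sum_Ico_reflect f 1 (m := q) (n := q) (by omega)
    rw [show q + 1 - q = 1 by omega, show q + 1 - 1 = q by omega] at this
    exact this
  have key : ∑ r ∈ Finset.Ico 1 q, Int.fract ((p : ℝ) * r / q) * h r =
      ∑ r ∈ Finset.Ico 1 q, h r - ∑ r ∈ Finset.Ico 1 q, Int.fract ((p : ℝ) * r / q) * h (q - r) := by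
    rw [← hrefl (fun r => Int.fract ((p : ℝ) * r / q) * h r), ← hrefl h, ← Finset.sum_sub_distrib]
    refine Finset.sum_congr rfl fun r hr => ?_
    show Int.fract ((p : ℝ) * ↑(q - r) / q) * h (q - r) = h (q - r) - Int.fract ((p : ℝ) * r / q) * h (q - r)
    rw [fract_mul_sub_div_eq hpq hr]
    ring
  have hsplit : ∑ r ∈ Finset.Ico 1 q, Int.fract ((p : ℝ) * r / q) * (h r - h (q - r)) =
      ∑ r ∈ Finset.Ico 1 q, Int.fract ((p : ℝ) * r / q) * h r
        - ∑ r ∈ Finset.Ico 1 q, Int.fract ((p : ℝ) * r / q) * h (q - r) := by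
    rw [← Finset.sum_sub_distrib]
    refine Finset.sum_congr rfl fun r _ => ?_
    ring
  rw [hsplit]
  linarith

/-- The antisymmetrised residue sum is the partial sum of the cotangent series:
`Σ_{n<M} (q/(qn+r) − q/(qn+(q−r))) = Σ_{n<M} (1/(n + r/q) − 1/(n + 1 − r/q))`. -/
theorem sum_range_div_sub_div_eq {q r : ℕ} (hq : 0 < q) (hr : r ∈ Finset.Ico 1 q) (M : ℕ) :
    ∑ n ∈ Finset.range M, (q : ℝ) / ((q : ℝ) * n + r)
        - ∑ n ∈ Finset.range M, (q : ℝ) / ((q : ℝ) * n + ↑(q - r)) =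
      ∑ n ∈ Finset.range M, (1 / ((n : ℝ) + (r : ℝ) / q) - 1 / ((n : ℝ) + 1 - (r : ℝ) / q)) := by
  rw [Finset.mem_Ico] at hr
  have hq0 : (q : ℝ) ≠ 0 := by exact_mod_cast hq.ne'
  rw [← Finset.sum_sub_distrib]
  refine Finset.sum_congr rfl fun n _ => ?_
  have e1 : ((q : ℝ) * n + r) / q = (n : ℝ) + (r : ℝ) / q := by
    rw [add_div, mul_div_cancel_left₀ _ hq0]
  have e2 : ((q : ℝ) * n + ((q : ℝ) - r)) / q = (n : ℝ) + 1 - (r : ℝ) / q := by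
    rw [add_div, mul_div_cancel_left₀ _ hq0, sub_div, div_self hq0]
    ring
  rw [Nat.cast_sub hr.2.le, ← e1, ← e2, one_div_div, one_div_div]

end Vasyunin
end Summit.RiemannHypothesis.RiemannHypothesis.Theorems.NbTheory

end
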